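import Literature.NumberTheory.Automorphic.UnitaryGroupAdelicCentralizerProduct   -- ★ :149 `exists_continuousMulEquiv_centralizer_toAdelic_of_singular` (the `Nonempty` form) and its ★ parts
import Literature.NumberTheory.Automorphic.UnitaryGroupAdelicProductHaar        -- ★ `Literature.MeasureTheory.Group.exists_map_continuousMulEquiv_eq_smul_prod` (ED. 2, §3)
import HarnessLib

/-!
# The adelic centraliser of a singular semisimple `γ ∈ U(H)(L⁺)` as `U(H_a)(𝔸) × U(H_b)(𝔸)`, EXPLICITLY: the map `(u_a, u_b) ↦ P (u_a ⊕ u_b) P⁻¹`,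
# and RATIONAL POINTS GO TO RATIONAL POINTS — the dock of Rogawski's §3.8 model onto the covolume factorisation
(Rogawski 1990, §3.8 Prop. 3.8.1 (a) p. 27 «`G_γ ≅ H′_ξ × E¹`»; §14.5 Lemma 14.5.2 (b) p. 238 «`m(I_γ(F)∖I_γ(𝔸)) = m(U(H_a)(F)∖U(H_a)(𝔸)) · m(E¹∖𝔸¹_E)`»)

Topic `NumberTheory/Automorphic`; namespace `Literature.NumberTheory.Automorphic.UnitaryGroup`.  THEOREMS ONLY (no definition, no instance, no notation, no
named fact, no `sorry`).  Cell `hodgecm-mathlib`, F0∕P3a road D-T, brick **«(K7-s)-DOCK»** (LEAD F0P3a-plan (g9) T8-14 (C)(1); A-p01 (g20); the dock named in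
F0P3-p03 (g8)'s (K7-s) census (c4)).  HONEST LABEL: count-neutral plumbing; the (K7-s) clause of ★ `TamagawaSingularMembersLetter` (floor 2: Weil∕Kottwitz
`τ(U(h) × U(1)) = 2·2` inner-form invariance, the (β) letter `UnitaryPlaneCovolInnerInvariant`) is NOT proved here; HC_CM is proved only modulo the printed
citations until rung 0 closes.

WHY.  ★ `exists_continuousMulEquiv_centralizer_toAdelic_of_singular` (`UnitaryGroupAdelicCentralizerProduct` :149) delivers, for a singular semisimple non-scalar
`γ ∈ U(H)(L⁺)` with frame `γP = P(a·1₂ ⊕ᶠ b·1₁)`, `ᵗP̄HP = H_a ⊕ᶠ H_b`, only `Nonempty (Z(γ ⊗ 1) ≃ₜ* U(H_a)(𝔸) × U(H_b)(𝔸))` — the isomorphism is a composite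
through two `rw … at` and carries NO formula and NO statement about rational points.  The consumer ★ `Literature.MeasureTheory.Group.covolume_count_eq_mul_of_mulEquiv_prod`
(F0P3-p03, p839613: `vol(Λ∖C) = vol(Γ₁∖G₁) · vol(Γ₂∖G₂)` along `e : G₁ × G₂ ≃* C` with `hΛe : ∀ g, e g ∈ Λ ↔ g ∈ Γ₁.prod Γ₂`) needs exactly the lattice clause
`hΛe` at `C := Z(toAdelic γ)`, `Λ := ((cmDatum L 3 H).quotientSubgroup ⊓ Z).subgroupOf Z` (the (K7-s) clause's covolume), `Γ_a := U(H_a)(L⁺)`, `Γ_b := U(H_b)(L⁺)`.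
This file REBUILDS the isomorphism from the same ★ parts with its underlying map pinned and proves the lattice clause:

* §1 GENERIC `exists_continuousMulEquiv_coe_eq_of_injective` — OPEN MAPPING THEOREM WITH THE FORMULA: a continuous injective homomorphism `f : G →* G′`
  from a σ-compact group onto a closed subgroup `C` of a locally compact Hausdorff group gives `e : G ≃ₜ* C` with `↑(e x) = f x`
  (Mathlib `MonoidHom.isOpenMap_of_sigmaCompact`; the ★ file's version is `private` and formula-free).
* §2 CM (`L` CM, `H ∈ M₃(L)` hermitian, `det H ≠ 0`; `γ : (cmDatum L 3 H).Rational` semisimple, not regular, not scalar — binders VERBATIM as ★ :149):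
  **`exists_frame_continuousMulEquiv_centralizer_toAdelic_of_singular`** — `∃ a b P H_a H_b, ‹the nine frame facts of ★ :149› ∧
  ∃ e : U(H_a)(𝔸) × U(H_b)(𝔸) ≃ₜ* Z(toAdelic γ)` with
  (FORMULA) `↑↑(e u) = P_𝔸 · reindexGL finSumFinEquiv (blockDiagGL (u.1, u.2)) · P_𝔸⁻¹` in `GL₃(𝔸_L)` (`P_𝔸 = toAdeleGL L P`);
  (RATIONAL POINTS) `↑(e u) ∈ U(H)(L⁺)` (★ `arithmeticSubgroup`) `↔ u.1 ∈ U(H_a)(L⁺) ∧ u.2 ∈ U(H_b)(L⁺)` — «⇐» ★ `adelicBlockDiag_toAdelic` + ★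
  `conj_mem_unitaryGroup_of_congr`; «⇒» a rational `w ∈ U(H)(L⁺)` commuting with `γ` has `P⁻¹wP ∈ U(H_a ⊕ᶠ H_b)(L⁺)` commuting with `a·1 ⊕ᶠ b·1`, hence
  block diagonal with RATIONAL unitary blocks (★ `mem_range_blockDiagFin_iff_commute` over the FIELD `L`), and `e` is injective;
  (LATTICE CLAUSE, token-exact for p839613's `hΛe`) `e u ∈ (((cmDatum L 3 H).quotientSubgroup ⊓ Z).subgroupOf Z) ↔ u ∈ (cmDatum L 2 H_a).quotientSubgroup.prod
  (cmDatum L 1 H_b).quotientSubgroup` (★ `cmDatum_quotientSubgroup` = `cmDatum_arithmeticSubgroup` = `adelicUnitaryRat`, `A_G = 1`);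
  `…_of_anisotropic` (semisimplicity automatic, ★ `isSemisimpleElt_of_anisotropic`).
NOT HERE (named residue): the Haar SPLITTING «given Haar `ν_Z` on `Z` and `ν_b` on `U(H_b)(𝔸)` there is a Haar `ν_a` with `e_*(ν_a ⊗ ν_b) = ν_Z`» (the `hν` of
p839613; generic Haar uniqueness on `G₁ × G₂`, cf. ★ `ProdRightFactorHaar` for the converse) and the one-line application of p839613 — both the (K7-s) payer's.
ED. 2 (§3) SUPPLIES the Haar splitting generically: `exists_isHaarMeasure_map_prod_eq_of_continuousMulEquiv` (over ★ `exists_map_continuousMulEquiv_eq_smul_prod`).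

References: [Rogawski1990] J. Rogawski, *Automorphic Representations of Unitary Groups in Three Variables* (1990), §3.8 Prop. 3.8.1 (a) p. 27, §14.5 L. 14.5.2 (b)
p. 238; [Gelbart1975] S. Gelbart, *Automorphic forms on adele groups* (1975), Remark 9.23; [HewittRoss1979] E. Hewitt, K. A. Ross, *Abstract Harmonic Analysis I*,
Thm. (5.29) (open mapping theorem for σ-compact locally compact groups) — through Mathlib `MonoidHom.isOpenMap_of_sigmaCompact`.
-/

set_option autoImplicit false

noncomputable section

open scoped MatrixGroups Matrix
open NumberField Topology

namespace Literature.NumberTheory.Automorphic.UnitaryGroup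

/-! ## §1 Open mapping theorem, `≃ₜ*` form WITH the underlying map -/

section Generic

variable {G G' : Type*} [Group G] [TopologicalSpace G] [IsTopologicalGroup G] [SigmaCompactSpace G]
  [Group G'] [TopologicalSpace G'] [IsTopologicalGroup G'] [LocallyCompactSpace G'] [T2Space G']

/-- **Open mapping theorem, explicit**: a continuous injective homomorphism `f : G →* G′` from a σ-compact group whose range is the closed subgroup
`C` of the locally compact Hausdorff group `G′` is an isomorphism of topological groups `e : G ≃ₜ* C` WITH `↑(e x) = f x` (Mathlib
`MonoidHom.isOpenMap_of_sigmaCompact` on the corestriction; the ★ `UnitaryGroupAdelicCentralizerProduct` version is `private` and `Nonempty`-valued).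
[cite: HewittRoss1979, Thm. (5.29)] -/
theorem exists_continuousMulEquiv_coe_eq_of_injective (f : G →* G') (hf : Function.Injective f) (hc : Continuous f) (C : Subgroup G')
    (hC : f.range = C) (hCc : IsClosed (C : Set G')) :
    ∃ e : G ≃ₜ* C, ∀ x, ((e x : C) : G') = f x := by
  let f' : G →* C := f.codRestrict C fun x => by rw [← hC]; exact ⟨x, rfl⟩
  have hf' : Function.Bijective f' := by
    refine ⟨fun x y hxy => hf (congrArg Subtype.val hxy), fun z => ?_⟩
    have hz : (z : G') ∈ f.range := by rw [hC]; exact z.2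
    obtain ⟨x, hx⟩ := hz
    exact ⟨x, Subtype.ext hx⟩
  have hfc' : Continuous f' := hc.subtype_mk _
  haveI : LocallyCompactSpace C := hCc.isClosedEmbedding_subtypeVal.locallyCompactSpace
  have hopen : IsOpenMap f' := MonoidHom.isOpenMap_of_sigmaCompact f' hf'.2 hfc'
  let eh : G ≃ₜ C := (Equiv.ofBijective f' hf').toHomeomorphOfContinuousOpen hfc' hopen
  exact ⟨{ MulEquiv.ofBijective f' hf' with continuous_toFun := eh.continuous, continuous_invFun := eh.symm.continuous }, fun _ => rfl⟩

/-- A group isomorphism respects centralisers of singletons: `e h ∈ Z(e g) ↔ h ∈ Z(g)`. [folklore] -/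
private theorem mulEquiv_apply_mem_centralizer_singleton_iff' {A B : Type*} [Group A] [Group B] (e : A ≃* B) (g h : A) :
    e h ∈ Subgroup.centralizer ({e g} : Set B) ↔ h ∈ Subgroup.centralizer ({g} : Set A) := by
  rw [Subgroup.mem_centralizer_singleton_iff, Subgroup.mem_centralizer_singleton_iff, ← map_mul, ← map_mul, e.apply_eq_iff_eq]

/-- The same along an isomorphism of topological groups. [folklore] -/
private theorem continuousMulEquiv_apply_mem_centralizer_singleton_iff' {A B : Type*} [Group A] [Group B] [TopologicalSpace A] [TopologicalSpace B]
    (e : A ≃ₜ* B) (g h : A) : e h ∈ Subgroup.centralizer ({e g} : Set B) ↔ h ∈ Subgroup.centralizer ({g} : Set A) := by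
  rw [Subgroup.mem_centralizer_singleton_iff, Subgroup.mem_centralizer_singleton_iff, ← map_mul, ← map_mul, e.injective.eq_iff]

end Generic

/-! ## §2 CM fields: the explicit `U(H_a)(𝔸) × U(H_b)(𝔸) ≃ₜ* Z(toAdelic γ)` at a singular semisimple `γ`, and its rational points -/

section CM

open Literature.NumberTheory.Rogawski1990
open Literature.AlgebraicGeometry.ShimuraVarieties (unitaryGroup mem_unitaryGroup_iff hermForm)

variable (L : Type) [Field L] [NumberField L] [IsCMField L] (H : Matrix (Fin 3) (Fin 3) L)

/-- **THE DOCK.**  For `L` CM, `H ∈ M₃(L)` hermitian non-degenerate and `γ ∈ U(H)(L⁺)` SEMISIMPLE, NOT REGULAR, NOT SCALAR: there are `a ≠ b`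
(`āa = b̄b = 1`), `P ∈ GL₃(L)`, hermitian non-degenerate `H_a ∈ M₂(L)`, `H_b ∈ M₁(L)` with `ᵗP̄HP = H_a ⊕ᶠ H_b`, `γP = P(a·1 ⊕ᶠ b·1)` (★
`exists_singular_frame_of_isSemisimpleElt`), AND an isomorphism of topological groups `e : U(H_a)(𝔸_{L⁺}) × U(H_b)(𝔸_{L⁺}) ≃ₜ* Z_{U(H)(𝔸_{L⁺})}(γ ⊗ 1)`
which (FORMULA) is `(u_a, u_b) ↦ P_𝔸 (u_a ⊕ u_b) P_𝔸⁻¹` on matrices, (RATIONAL POINTS) carries `U(H_a)(L⁺) × U(H_b)(L⁺)` ONTO `Z ∩ U(H)(L⁺)`, and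
(LATTICE CLAUSE) satisfies the `hΛe` hypothesis of ★ `covolume_count_eq_mul_of_mulEquiv_prod` for `Λ := ((quotientSubgroup ⊓ Z).subgroupOf Z)` — so the
singular covolume of the (K7-s) clause FACTORS as `m(U(H_a)(L⁺)∖U(H_a)(𝔸)) · m(U(H_b)(L⁺)∖U(H_b)(𝔸))` for any Haar data matched along `e`.
[cite: Rogawski1990, §3.8 Prop. 3.8.1 p. 27; §14.5 Lemma 14.5.2 (b) p. 238] [cite: Gelbart1975, Remark 9.23] -/
theorem exists_frame_continuousMulEquiv_centralizer_toAdelic_of_singular (hH : (H.map (cmConjRingHom L))ᵀ = H) (hdet : H.det ≠ 0)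
    (γ : (cmDatum L 3 H).Rational) (hss : Rogawski1990.IsSemisimpleElt (cmConjRingHom L) H γ)
    (hnreg : ¬ IsRegularElt (γ.val : GL (Fin 3) L)) (hnsc : ∀ ζ : L, ((γ.val : GL (Fin 3) L) : Matrix (Fin 3) (Fin 3) L) ≠ ζ • 1) :
    ∃ (a b : L) (P : GL (Fin 3) L) (Ha : Matrix (Fin 2) (Fin 2) L) (Hb : Matrix (Fin 1) (Fin 1) L),
      a ≠ b ∧ cmConjRingHom L a * a = 1 ∧ cmConjRingHom L b * b = 1 ∧
      (((P : Matrix (Fin 3) (Fin 3) L)).map (cmConjRingHom L))ᵀ * H * (P : Matrix (Fin 3) (Fin 3) L) = finSum 2 1 Ha Hb ∧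
      ((γ.val : GL (Fin 3) L) : Matrix (Fin 3) (Fin 3) L) * (P : Matrix (Fin 3) (Fin 3) L) =
        (P : Matrix (Fin 3) (Fin 3) L) * finSum 2 1 (a • (1 : Matrix (Fin 2) (Fin 2) L)) (b • (1 : Matrix (Fin 1) (Fin 1) L)) ∧
      (Ha.map (cmConjRingHom L))ᵀ = Ha ∧ (Hb.map (cmConjRingHom L))ᵀ = Hb ∧ Ha.det ≠ 0 ∧ Hb.det ≠ 0 ∧
      ∃ e : ((cmDatum L 2 Ha).Adelic × (cmDatum L 1 Hb).Adelic) ≃ₜ*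
          ↥(Subgroup.centralizer ({(cmDatum L 3 H).toAdelic γ} : Set (cmDatum L 3 H).Adelic)),
        (∀ u, (((e u : ↥(Subgroup.centralizer ({(cmDatum L 3 H).toAdelic γ} : Set (cmDatum L 3 H).Adelic))) :
              (cmDatum L 3 H).Adelic).val : GL (Fin 3) (AdeleRing (𝓞 L) L)) =
            toAdeleGL L P * reindexGL finSumFinEquiv (blockDiagGL (u.1.val, u.2.val)) * (toAdeleGL L P)⁻¹) ∧
        (∀ u, ((e u : ↥(Subgroup.centralizer ({(cmDatum L 3 H).toAdelic γ} : Set (cmDatum L 3 H).Adelic))) :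
              (cmDatum L 3 H).Adelic) ∈ (cmDatum L 3 H).arithmeticSubgroup ↔
            u.1 ∈ (cmDatum L 2 Ha).arithmeticSubgroup ∧ u.2 ∈ (cmDatum L 1 Hb).arithmeticSubgroup) ∧
        (∀ u, e u ∈ ((cmDatum L 3 H).quotientSubgroup ⊓
              Subgroup.centralizer ({(cmDatum L 3 H).toAdelic γ} : Set (cmDatum L 3 H).Adelic)).subgroupOf
              (Subgroup.centralizer ({(cmDatum L 3 H).toAdelic γ} : Set (cmDatum L 3 H).Adelic)) ↔
            u ∈ ((cmDatum L 2 Ha).quotientSubgroup).prod ((cmDatum L 1 Hb).quotientSubgroup)) := by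
  have hσ : ∀ x : L, cmConjRingHom L (cmConjRingHom L x) = x := IsCMField.complexConj_apply_apply L
  obtain ⟨a, b, P, Ha, Hb, hab, haa, hbb, hP, hγP, hHa, hHb, hda, hdb⟩ :=
    exists_singular_frame_of_isSemisimpleElt (cmConjRingHom L) hσ H hH hdet γ hss hnreg hnsc
  refine ⟨a, b, P, Ha, Hb, hab, haa, hbb, hP, hγP, hHa, hHb, hda, hdb, ?_⟩
  -- notation: the block form `H′`, the block scalar `δ₀ = P⁻¹ γ P`, the centraliser `C`
  set H' : Matrix (Fin 3) (Fin 3) L := finSum 2 1 Ha Hb with hH'def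
  set C : Subgroup (cmDatum L 3 H).Adelic := Subgroup.centralizer ({(cmDatum L 3 H).toAdelic γ} : Set (cmDatum L 3 H).Adelic) with hCdef
  set δ₀ : GL (Fin 3) L := P⁻¹ * (γ.val : GL (Fin 3) L) * P with hδ₀def
  have hδ₀ : (δ₀ : Matrix (Fin 3) (Fin 3) L) = finSum 2 1 (a • (1 : Matrix (Fin 2) (Fin 2) L)) (b • 1) := by
    rw [hδ₀def, Units.val_mul, Units.val_mul, Matrix.mul_assoc, hγP, ← Matrix.mul_assoc, ← Units.val_mul, inv_mul_cancel,
      Units.val_one, Matrix.one_mul]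
  have hγδ₀ : (γ.val : GL (Fin 3) L) = P * δ₀ * P⁻¹ := by
    rw [hδ₀def, ← mul_assoc, ← mul_assoc, mul_inv_cancel, one_mul, mul_assoc, mul_inv_cancel, mul_one]
  -- the congruence `P⁻¹` carries `H′` to `H`
  have hP' : (((P⁻¹ : GL (Fin 3) L) : Matrix (Fin 3) (Fin 3) L).map (cmConjRingHom L))ᵀ * H' *
      ((P⁻¹ : GL (Fin 3) L) : Matrix (Fin 3) (Fin 3) L) = H := by
    rw [← hP]
    have h1 : (((P⁻¹ : GL (Fin 3) L) : Matrix (Fin 3) (Fin 3) L).map (cmConjRingHom L))ᵀ *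
        (((P : Matrix (Fin 3) (Fin 3) L)).map (cmConjRingHom L))ᵀ = 1 := by
      rw [← Matrix.transpose_mul, ← Matrix.map_mul, ← Units.val_mul, mul_inv_cancel, Units.val_one,
        Matrix.map_one _ (map_zero _) (map_one _), Matrix.transpose_one]
    calc (((P⁻¹ : GL (Fin 3) L) : Matrix (Fin 3) (Fin 3) L).map (cmConjRingHom L))ᵀ *
          ((((P : Matrix (Fin 3) (Fin 3) L)).map (cmConjRingHom L))ᵀ * H * (P : Matrix (Fin 3) (Fin 3) L)) *
          ((P⁻¹ : GL (Fin 3) L) : Matrix (Fin 3) (Fin 3) L)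
        = ((((P⁻¹ : GL (Fin 3) L) : Matrix (Fin 3) (Fin 3) L).map (cmConjRingHom L))ᵀ *
            (((P : Matrix (Fin 3) (Fin 3) L)).map (cmConjRingHom L))ᵀ) * H *
            ((P : Matrix (Fin 3) (Fin 3) L) * ((P⁻¹ : GL (Fin 3) L) : Matrix (Fin 3) (Fin 3) L)) := by
          simp only [Matrix.mul_assoc]
      _ = H := by rw [h1, ← Units.val_mul, mul_inv_cancel, Units.val_one, Matrix.one_mul, Matrix.mul_one]
  -- `δ₀ ∈ U(H′)(L⁺)`, in both currencies
  have hδ₀mem : δ₀ ∈ unitaryGroup (cmConjRingHom L) H' := by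
    have h := conj_mem_unitaryGroup_of_congr (cmConjRingHom L) (P⁻¹) H' H hP' (x := (γ.val : GL (Fin 3) L)) γ.2
    rwa [inv_inv] at h
  let δ' : rational (↥(maximalRealSubfield L)) L (IsCMField.complexConj L) (2 + 1) (finSum 2 1 Ha Hb) :=
    ⟨δ₀, by rw [rational_complexConj]; exact hδ₀mem⟩
  have hδ' : ((δ' : GL (Fin (2 + 1)) L) : Matrix _ _ L) = finSum 2 1 (a • (1 : Matrix (Fin 2) (Fin 2) L)) (b • 1) := hδ₀
  -- the three identity-on-matrices identifications between the generic and the `cmDatum` carriers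
  let ιa : (cmDatum L 2 Ha).Adelic ≃* ↥(adelic (↥(maximalRealSubfield L)) L (IsCMField.complexConj L) 2 Ha) :=
    MulEquiv.subgroupCongr (adelic_complexConj L 2 Ha).symm
  let ιb : (cmDatum L 1 Hb).Adelic ≃* ↥(adelic (↥(maximalRealSubfield L)) L (IsCMField.complexConj L) 1 Hb) :=
    MulEquiv.subgroupCongr (adelic_complexConj L 1 Hb).symm
  let κ : ↥(adelic (↥(maximalRealSubfield L)) L (IsCMField.complexConj L) (2 + 1) (finSum 2 1 Ha Hb)) ≃* (cmDatum L 3 H').Adelic :=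
    MulEquiv.subgroupCongr (adelic_complexConj L (2 + 1) (finSum 2 1 Ha Hb))
  -- the congruence `P`: `U(H′)(𝔸) ≃ₜ* U(H)(𝔸)`, `x ↦ P_𝔸 x P_𝔸⁻¹`
  let θ : (cmDatum L 3 H').Adelic ≃ₜ* (cmDatum L 3 H).Adelic := adelicUnitaryGroupCongr L P H H' hP
  -- the explicit homomorphism `Φ (u_a, u_b) = P_𝔸 (u_a ⊕ u_b) P_𝔸⁻¹`
  let Φ : (cmDatum L 2 Ha).Adelic × (cmDatum L 1 Hb).Adelic →* (cmDatum L 3 H).Adelic :=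
    θ.toMulEquiv.toMonoidHom.comp (κ.toMonoidHom.comp
      ((adelicBlockDiag (↥(maximalRealSubfield L)) L (IsCMField.complexConj L) 2 1 Ha Hb).comp (ιa.toMonoidHom.prodMap ιb.toMonoidHom)))
  have hΦapply : ∀ u, Φ u = θ (κ (adelicBlockDiag (↥(maximalRealSubfield L)) L (IsCMField.complexConj L) 2 1 Ha Hb (ιa u.1, ιb u.2))) :=
    fun u => rfl
  have hΦval : ∀ u, ((Φ u : (cmDatum L 3 H).Adelic).val : GL (Fin 3) (AdeleRing (𝓞 L) L)) =
      toAdeleGL L P * reindexGL finSumFinEquiv (blockDiagGL (u.1.val, u.2.val)) * (toAdeleGL L P)⁻¹ := fun u => rfl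
  have hΦc : Continuous Φ := by
    have hκc : Continuous κ := by
      refine continuous_induced_rng.2 ?_
      exact continuous_subtype_val
    have hιac : Continuous ιa := by
      refine continuous_induced_rng.2 ?_
      exact continuous_subtype_val
    have hιbc : Continuous ιb := by
      refine continuous_induced_rng.2 ?_
      exact continuous_subtype_val
    exact θ.continuous.comp (hκc.comp ((continuous_adelicBlockDiag (↥(maximalRealSubfield L)) L (IsCMField.complexConj L) 2 1 Ha Hb).comp
      ((hιac.comp continuous_fst).prodMk (hιbc.comp continuous_snd))))
  have hΦinj : Function.Injective Φ := by
    intro u v huv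
    rw [hΦapply, hΦapply] at huv
    have h := adelicBlockDiag_injective (↥(maximalRealSubfield L)) L (IsCMField.complexConj L) 2 1 Ha Hb (κ.injective (θ.injective huv))
    simp only [Prod.mk.injEq] at h
    exact Prod.ext (ιa.injective h.1) (ιb.injective h.2)
  -- `θ ∘ κ` sends `toAdelic δ′` to `toAdelic γ`
  have hγeq : θ (κ (toAdelic (↥(maximalRealSubfield L)) L (IsCMField.complexConj L) (2 + 1) (finSum 2 1 Ha Hb) δ')) =
      (cmDatum L 3 H).toAdelic γ := by
    apply Subtype.ext
    show toAdeleGL L P * toAdeleGL L δ₀ * (toAdeleGL L P)⁻¹ = toAdeleGL L (γ.val : GL (Fin 3) L)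
    rw [← map_inv, ← map_mul, ← map_mul, ← hγδ₀]
  -- the range of `Φ` is the centraliser
  have hrange : Φ.range = C := by
    have hr := centralizer_toAdelic_eq_range_adelicBlockDiag (↥(maximalRealSubfield L)) L (IsCMField.complexConj L) 2 1 Ha Hb hab δ' hδ'
    ext z
    rw [MonoidHom.mem_range, hCdef]
    constructor
    · rintro ⟨u, rfl⟩
      rw [hΦapply, ← hγeq, continuousMulEquiv_apply_mem_centralizer_singleton_iff' θ,
        mulEquiv_apply_mem_centralizer_singleton_iff' κ, hr]
      exact ⟨_, rfl⟩
    · intro hz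
      have hz' : κ.symm (θ.symm z) ∈ Subgroup.centralizer
          ({toAdelic (↥(maximalRealSubfield L)) L (IsCMField.complexConj L) (2 + 1) (finSum 2 1 Ha Hb) δ'} : Set _) := by
        rw [← mulEquiv_apply_mem_centralizer_singleton_iff' κ,
          ← continuousMulEquiv_apply_mem_centralizer_singleton_iff' θ, MulEquiv.apply_symm_apply,
          ContinuousMulEquiv.apply_symm_apply, hγeq]
        exact hz
      rw [hr] at hz'
      obtain ⟨v, hv⟩ := hz'
      refine ⟨(ιa.symm v.1, ιb.symm v.2), ?_⟩
      rw [hΦapply]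
      show θ (κ (adelicBlockDiag _ L _ 2 1 Ha Hb (ιa (ιa.symm v.1), ιb (ιb.symm v.2)))) = z
      rw [MulEquiv.apply_symm_apply, MulEquiv.apply_symm_apply, Prod.mk.eta, hv, MulEquiv.apply_symm_apply,
        ContinuousMulEquiv.apply_symm_apply]
  -- the isomorphism, by the open mapping theorem
  have hCc : IsClosed (C : Set (cmDatum L 3 H).Adelic) := Set.isClosed_centralizer _
  obtain ⟨e, he⟩ := exists_continuousMulEquiv_coe_eq_of_injective Φ hΦinj hΦc C hrange hCc
  -- the formula
  have hformula : ∀ u, (((e u : C) : (cmDatum L 3 H).Adelic).val : GL (Fin 3) (AdeleRing (𝓞 L) L)) =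
      toAdeleGL L P * reindexGL finSumFinEquiv (blockDiagGL (u.1.val, u.2.val)) * (toAdeleGL L P)⁻¹ := fun u => by
    rw [he]; exact hΦval u
  -- `toAdeleGL` of a rational block-diagonal matrix
  have hmapbd : ∀ (x₁ : GL (Fin 2) L) (x₂ : GL (Fin 1) L),
      toAdeleGL L (reindexGL finSumFinEquiv (blockDiagGL (x₁, x₂))) = reindexGL finSumFinEquiv (blockDiagGL (toAdeleGL L x₁, toAdeleGL L x₂)) :=
    fun x₁ x₂ => by rw [toAdeleGL, map_reindexGL, map_blockDiagGL]
  -- rational points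
  have hrat : ∀ u, ((e u : C) : (cmDatum L 3 H).Adelic) ∈ (cmDatum L 3 H).arithmeticSubgroup ↔
      u.1 ∈ (cmDatum L 2 Ha).arithmeticSubgroup ∧ u.2 ∈ (cmDatum L 1 Hb).arithmeticSubgroup := by
    intro u
    constructor
    · -- «⇒»: a rational element of the centraliser has rational blocks
      intro h
      obtain ⟨wR, hwR⟩ := MonoidHom.mem_range.mp h
      set w : GL (Fin 3) L := wR.val with hwdef
      have hw : w ∈ unitaryGroup (cmConjRingHom L) H := wR.2
      have hwval : toAdeleGL L w = (((e u : C) : (cmDatum L 3 H).Adelic).val : GL (Fin 3) (AdeleRing (𝓞 L) L)) := by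
        rw [← hwR, coe_cmDatum_toAdelic]
      -- `w` commutes with `γ` (injectivity of `U(H)(L⁺) → U(H)(𝔸)`)
      have hcommA := Subgroup.mem_centralizer_singleton_iff.1 (e u).2
      have hcommR : wR * γ = γ * wR := by
        apply cmDatum_toAdelic_injective L 3 H
        rw [map_mul, map_mul, hwR]
        exact hcommA
      have hcomm : w * (γ.val : GL (Fin 3) L) = (γ.val : GL (Fin 3) L) * w := congrArg Subtype.val hcommR
      -- `w′ = P⁻¹ w P ∈ U(H′)(L⁺)` commutes with `δ₀ = a·1 ⊕ᶠ b·1`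
      have hw' : P⁻¹ * w * P ∈ unitaryGroup (cmConjRingHom L) H' := by
        have h := conj_mem_unitaryGroup_of_congr (cmConjRingHom L) (P⁻¹) H' H hP' hw
        rwa [inv_inv] at h
      let w'' : rational (↥(maximalRealSubfield L)) L (IsCMField.complexConj L) (2 + 1) (finSum 2 1 Ha Hb) :=
        ⟨P⁻¹ * w * P, by rw [rational_complexConj]; exact hw'⟩
      have hcomm' : ((w'' : GL (Fin (2 + 1)) L) : Matrix _ _ L) * finSum 2 1 (a • (1 : Matrix (Fin 2) (Fin 2) L)) (b • 1) =
          finSum 2 1 (a • (1 : Matrix (Fin 2) (Fin 2) L)) (b • 1) * ((w'' : GL (Fin (2 + 1)) L) : Matrix _ _ L) := by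
        rw [← hδ₀]
        show ((P⁻¹ * w * P : GL (Fin 3) L) : Matrix (Fin 3) (Fin 3) L) * (δ₀ : Matrix (Fin 3) (Fin 3) L) =
          (δ₀ : Matrix (Fin 3) (Fin 3) L) * ((P⁻¹ * w * P : GL (Fin 3) L) : Matrix (Fin 3) (Fin 3) L)
        rw [← Units.val_mul, ← Units.val_mul, hδ₀def]
        congr 1
        calc P⁻¹ * w * P * (P⁻¹ * (γ.val : GL (Fin 3) L) * P) = P⁻¹ * (w * (γ.val : GL (Fin 3) L)) * P := by group
          _ = P⁻¹ * ((γ.val : GL (Fin 3) L) * w) * P := by rw [hcomm]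
          _ = P⁻¹ * (γ.val : GL (Fin 3) L) * P * (P⁻¹ * w * P) := by group
      have hab' : IsUnit (a - b) := isUnit_iff_ne_zero.2 (sub_ne_zero.2 hab)
      obtain ⟨y, hy⟩ := (mem_range_blockDiagFin_iff_commute (IsCMField.complexConj L : L →+* L) Ha Hb hab' w'').2 hcomm'
      -- the rational preimage
      have hy₁ : (y.1 : GL (Fin 2) L) ∈ unitaryGroup (cmConjRingHom L) Ha := by rw [← rational_complexConj]; exact y.1.2
      have hy₂ : (y.2 : GL (Fin 1) L) ∈ unitaryGroup (cmConjRingHom L) Hb := by rw [← rational_complexConj]; exact y.2.2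
      set u₀ : (cmDatum L 2 Ha).Adelic × (cmDatum L 1 Hb).Adelic :=
        ((cmDatum L 2 Ha).toAdelic ⟨(y.1 : GL (Fin 2) L), hy₁⟩, (cmDatum L 1 Hb).toAdelic ⟨(y.2 : GL (Fin 1) L), hy₂⟩) with hu₀
      have hyval : reindexGL finSumFinEquiv (blockDiagGL ((y.1 : GL (Fin 2) L), (y.2 : GL (Fin 1) L))) = P⁻¹ * w * P := by
        rw [← coe_blockDiagFin_eq, hy]
      have heq : e u₀ = e u := by
        apply Subtype.ext
        apply Subtype.ext
        rw [hformula, hformula, hu₀, coe_cmDatum_toAdelic, coe_cmDatum_toAdelic]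
        show toAdeleGL L P * reindexGL finSumFinEquiv (blockDiagGL (toAdeleGL L (y.1 : GL (Fin 2) L), toAdeleGL L (y.2 : GL (Fin 1) L))) *
            (toAdeleGL L P)⁻¹ = toAdeleGL L P * reindexGL finSumFinEquiv (blockDiagGL (u.1.val, u.2.val)) * (toAdeleGL L P)⁻¹
        rw [← hmapbd, hyval, ← hformula u, ← hwval, ← map_inv, ← map_mul, ← map_mul]
        congr 1
        group
      have hu : u = u₀ := e.injective heq.symm
      rw [hu, hu₀]
      exact ⟨MonoidHom.mem_range.mpr ⟨_, rfl⟩, MonoidHom.mem_range.mpr ⟨_, rfl⟩⟩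
    · -- «⇐»: rational blocks give a rational element
      rintro ⟨h₁, h₂⟩
      obtain ⟨y₁, hy₁⟩ := MonoidHom.mem_range.mp h₁
      obtain ⟨y₂, hy₂⟩ := MonoidHom.mem_range.mp h₂
      set x₁ : GL (Fin 2) L := y₁.val with hx₁def
      set x₂ : GL (Fin 1) L := y₂.val with hx₂def
      have hx₁v : toAdeleGL L x₁ = (u.1.val : GL (Fin 2) (AdeleRing (𝓞 L) L)) := by rw [← hy₁, coe_cmDatum_toAdelic]
      have hx₂v : toAdeleGL L x₂ = (u.2.val : GL (Fin 1) (AdeleRing (𝓞 L) L)) := by rw [← hy₂, coe_cmDatum_toAdelic]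
      have hx₁' : x₁ ∈ rational (↥(maximalRealSubfield L)) L (IsCMField.complexConj L) 2 Ha := by rw [rational_complexConj]; exact y₁.2
      have hx₂' : x₂ ∈ rational (↥(maximalRealSubfield L)) L (IsCMField.complexConj L) 1 Hb := by rw [rational_complexConj]; exact y₂.2
      have hmid : reindexGL finSumFinEquiv (blockDiagGL (x₁, x₂)) ∈ unitaryGroup (cmConjRingHom L) H' := by
        rw [← rational_complexConj, ← coe_blockDiagFin_eq (IsCMField.complexConj L : L →+* L) Ha Hb (⟨x₁, hx₁'⟩, ⟨x₂, hx₂'⟩)]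
        exact (blockDiagFin (IsCMField.complexConj L : L →+* L) Ha Hb (⟨x₁, hx₁'⟩, ⟨x₂, hx₂'⟩)).2
      refine MonoidHom.mem_range.mpr ⟨⟨P * reindexGL finSumFinEquiv (blockDiagGL (x₁, x₂)) * P⁻¹,
        conj_mem_unitaryGroup_of_congr (cmConjRingHom L) P H H' hP hmid⟩, Subtype.ext ?_⟩
      rw [coe_cmDatum_toAdelic, map_mul, map_mul, map_inv, hmapbd, hx₁v, hx₂v, hformula]
  refine ⟨e, hformula, hrat, fun u => ?_⟩
  -- the lattice clause
  rw [Subgroup.mem_subgroupOf, Subgroup.mem_inf, Subgroup.mem_prod, cmDatum_quotientSubgroup, cmDatum_quotientSubgroup, cmDatum_quotientSubgroup,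
    ← cmDatum_arithmeticSubgroup, ← cmDatum_arithmeticSubgroup, ← cmDatum_arithmeticSubgroup]
  exact ⟨fun h => (hrat u).1 h.1, fun h => ⟨(hrat u).2 h, (e u).2⟩⟩

/-- **Anisotropic `H`**: the same dock for every NON-REGULAR, NON-SCALAR `γ ∈ U(H)(L⁺)` (semisimplicity is automatic for anisotropic forms, ★
`isSemisimpleElt_of_anisotropic`). [cite: Rogawski1990, §3.8 Prop. 3.8.1 p. 27] -/
theorem exists_frame_continuousMulEquiv_centralizer_toAdelic_of_anisotropic (hH : (H.map (cmConjRingHom L))ᵀ = H) (hdet : H.det ≠ 0)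
    (hanis : ∀ x : Fin 3 → L, hermForm (cmConjRingHom L) H x x = 0 → x = 0)
    (γ : (cmDatum L 3 H).Rational) (hnreg : ¬ IsRegularElt (γ.val : GL (Fin 3) L))
    (hnsc : ∀ ζ : L, ((γ.val : GL (Fin 3) L) : Matrix (Fin 3) (Fin 3) L) ≠ ζ • 1) :
    ∃ (a b : L) (P : GL (Fin 3) L) (Ha : Matrix (Fin 2) (Fin 2) L) (Hb : Matrix (Fin 1) (Fin 1) L),
      a ≠ b ∧ cmConjRingHom L a * a = 1 ∧ cmConjRingHom L b * b = 1 ∧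
      (((P : Matrix (Fin 3) (Fin 3) L)).map (cmConjRingHom L))ᵀ * H * (P : Matrix (Fin 3) (Fin 3) L) = finSum 2 1 Ha Hb ∧
      ((γ.val : GL (Fin 3) L) : Matrix (Fin 3) (Fin 3) L) * (P : Matrix (Fin 3) (Fin 3) L) =
        (P : Matrix (Fin 3) (Fin 3) L) * finSum 2 1 (a • (1 : Matrix (Fin 2) (Fin 2) L)) (b • (1 : Matrix (Fin 1) (Fin 1) L)) ∧
      (Ha.map (cmConjRingHom L))ᵀ = Ha ∧ (Hb.map (cmConjRingHom L))ᵀ = Hb ∧ Ha.det ≠ 0 ∧ Hb.det ≠ 0 ∧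
      ∃ e : ((cmDatum L 2 Ha).Adelic × (cmDatum L 1 Hb).Adelic) ≃ₜ*
          ↥(Subgroup.centralizer ({(cmDatum L 3 H).toAdelic γ} : Set (cmDatum L 3 H).Adelic)),
        (∀ u, (((e u : ↥(Subgroup.centralizer ({(cmDatum L 3 H).toAdelic γ} : Set (cmDatum L 3 H).Adelic))) :
              (cmDatum L 3 H).Adelic).val : GL (Fin 3) (AdeleRing (𝓞 L) L)) =
            toAdeleGL L P * reindexGL finSumFinEquiv (blockDiagGL (u.1.val, u.2.val)) * (toAdeleGL L P)⁻¹) ∧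
        (∀ u, ((e u : ↥(Subgroup.centralizer ({(cmDatum L 3 H).toAdelic γ} : Set (cmDatum L 3 H).Adelic))) :
              (cmDatum L 3 H).Adelic) ∈ (cmDatum L 3 H).arithmeticSubgroup ↔
            u.1 ∈ (cmDatum L 2 Ha).arithmeticSubgroup ∧ u.2 ∈ (cmDatum L 1 Hb).arithmeticSubgroup) ∧
        (∀ u, e u ∈ ((cmDatum L 3 H).quotientSubgroup ⊓
              Subgroup.centralizer ({(cmDatum L 3 H).toAdelic γ} : Set (cmDatum L 3 H).Adelic)).subgroupOf
              (Subgroup.centralizer ({(cmDatum L 3 H).toAdelic γ} : Set (cmDatum L 3 H).Adelic)) ↔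
            u ∈ ((cmDatum L 2 Ha).quotientSubgroup).prod ((cmDatum L 1 Hb).quotientSubgroup)) :=
  exists_frame_continuousMulEquiv_centralizer_toAdelic_of_singular L H hH hdet γ
    (isSemisimpleElt_of_anisotropic (cmConjRingHom L) H hanis γ) hnreg hnsc

end CM

/-! ## §3 (ED. 2) The Haar SPLITTING along the dock — the `hν` binder of ★ p839613 ∕ ★ (K7-s)-SPLIT discharged -/

section Splitting

open _root_.MeasureTheory _root_.MeasureTheory.Measure
open scoped NNReal

/-- **Haar measures split along an isomorphism onto a product**: for an isomorphism of topological groups `e : G_a × G_b ≃ₜ* C` (second-countable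
locally compact factors), EVERY Haar measure `ν_C` on `C` and EVERY Haar measure `ν_b` on `G_b` admit a Haar measure `ν_a` on `G_a` with
`e_* (ν_a ⊗ ν_b) = ν_C` — `e⁻¹_* ν_C = κ · (μ_a ⊗ ν_b)` by Haar uniqueness on `G_a × G_b` (★ `exists_map_continuousMulEquiv_eq_smul_prod`), take `ν_a := κ · μ_a`.
At the dock `e : U(H_a)(𝔸) × U(H_b)(𝔸) ≃ₜ* Z(toAdelic γ)` of §2 this is exactly the hypothesis `hν : Measure.map e (ν_a.prod ν_b) = ν_Z` of ★
`covolume_count_eq_mul_of_mulEquiv_prod` (F0P3-p03 p839613) ∕ ★ (K7-s)-SPLIT, for the GIVEN centraliser Haar measure `ν_Z c` of the (K7-s) clause and any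
Haar measure on the `U(1)`-type factor (the converse direction — the right factor of a product decomposition is Haar — is ★ `ProdRightFactorHaar`).
[cite: Bump1997, §3.3 Prop. 3.3.2] [cite: Gelbart1975, Remark 9.23] -/
theorem exists_isHaarMeasure_map_prod_eq_of_continuousMulEquiv {Ga Gb C : Type*}
    [Group Ga] [TopologicalSpace Ga] [IsTopologicalGroup Ga] [MeasurableSpace Ga] [BorelSpace Ga] [SecondCountableTopology Ga] [LocallyCompactSpace Ga]
    [Group Gb] [TopologicalSpace Gb] [IsTopologicalGroup Gb] [MeasurableSpace Gb] [BorelSpace Gb] [SecondCountableTopology Gb] [LocallyCompactSpace Gb]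
    [Group C] [TopologicalSpace C] [IsTopologicalGroup C] [MeasurableSpace C] [BorelSpace C]
    (e : (Ga × Gb) ≃ₜ* C) (νC : Measure C) [νC.IsHaarMeasure] (νb : Measure Gb) [νb.IsHaarMeasure] :
    ∃ νa : Measure Ga, νa.IsHaarMeasure ∧ Measure.map e (νa.prod νb) = νC := by
  obtain ⟨κ, hκ, hmap⟩ := Literature.MeasureTheory.Group.exists_map_continuousMulEquiv_eq_smul_prod e.symm νC Measure.haar νb
  refine ⟨κ • Measure.haar, IsHaarMeasure.nnreal_smul Measure.haar hκ.ne', ?_⟩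
  rw [Measure.prod_smul_left, ← hmap]
  exact MeasurableEquiv.map_symm_map e.symm.toHomeomorph.toMeasurableEquiv (μ := νC)

end Splitting

end Literature.NumberTheory.Automorphic.UnitaryGroup

end
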